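import Mathlib
import Literature.Barriers.ValiantsHypothesis.AlgebraicNaturalProofs
import Summits.ValiantsHypothesis.ValiantsHypothesis.Theorems.BarrierLeverPartitionMinorsHitByVPTwoBlockTropical
import Summits.ValiantsHypothesis.ValiantsHypothesis.Theorems.BarrierLeverPartitionMinorsHitByVPProductStatesGeneral

/-!
# Route BarrierLever — item `PartitionMinorsHitByVP` (stmt-ValiantsHypothesis-19717):
# the BI-THRESHOLD DOOR (D-THR) — two nonsingular threshold cells ⇒ the layout is hit, `b = 3`

Helper file (`--supports stmt-ValiantsHypothesis-19717`; cell valiant-natproofs, rung V4, 𝒟-side,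
prover seat valiant-natproofs-prover gen 6; memo `HOME/prover/gen6/ADAPTIVE-WITNESSES-MEMO-g6.md`
§5–§7). Definition-free. Closes NO item. Part 2b of the door; parts 1 (`…TwoBlockTropical`) and 2a
(`…ProductStatesGeneral`) are imported.

**Theorem (`partitionMinor_hit_of_thresholdSplit`).** Let `(u, w)` be a layout (`h ≥ 4`; no
injectivity needed), `λ, μ : Fin h → ℤ` weights with cuts `cu, cw`, and put
`S = {i : cu < Σ_{a ∈ u i} λ a}`, `T = {j : cw < Σ_{c ∈ w j} μ c}`. Given bijections `e : S ≃ T`,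
`e' : Sᶜ ≃ Tᶜ` and two product states `P, Q` (arbitrary complex site tables) whose cell minors
`det [P(u i, w (e i'))]_{i,i' ∈ S}` and `det [Q(u i, w (e' i'))]_{i,i' ∈ Sᶜ}` are nonzero, some
`f ∈ SmallCircuits ℂ (h+h) 3` makes the partition minor `[U, W]` of item 19717 nonsingular.

*Proof.* Odd integer margins `a_i = 2(Σλ − cu) − 1`, `b_j = 2(Σμ − cw) − 1` (positive exactly on
`S`, `T`), `L = 1 + Σ|b|`, `C₀ = L Σ|a| + Σ|b|`, exponents `d(i,j) = C₀ + L a_i + b_j ≥ 0` (sign of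
`a_i`), `c₀ = C₀`. For a permutation `σ` the degree budget is
`Σ_j max(d(σ j, j), c₀) = r C₀ + L Σ_S a + Σ_j [σ j ∈ S] b_j`, and POINTWISE
`[σ j ∈ S] b_j ≤ [j ∈ T] b_j` with equality iff `σ j ∈ S ↔ j ∈ T` (`ite_le_ite_of_sign`) — so the
budget `N = r C₀ + L Σ_S a + Σ_T b` is attained exactly by the block-compatible permutations. The
two-block tropical lemma (part 1) gives `det A(X) ≠ 0` for
`A = (C p_{ij} X^{d(i,j)} + C q_{ij} X^{c₀})`; a point `x₀ ≠ 0` off the roots of `X · det A` and the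
two product states `x₀^K · P'` (sites of `P` scaled by `x₀^{2Lλ_a}`, `x₀^{2μ_a}`) and `x₀^{c₀} · Q`
realise `A(x₀)` as the layout minor (part 2a's coefficient formula, `zpow` bookkeeping).

Census (kit j253355/j253364/j253366/j253367, h = 3 exhaustive, h ≤ 7 sampled): EVERY layout tested is
either certified by one product state or splits by such a bi-threshold into two certified cells.

WHAT THIS IS NOT: the existence of a good bi-threshold split for every layout is OPEN (that is the
remaining content of item 19717 on this line); nothing on crux 14610 / VP vs VNP.
-/

set_option linter.dupNamespace false

/-! # Part 2b — the bi-threshold door -/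

namespace Summit.ValiantsHypothesis.ValiantsHypothesis.Theorems.BarrierLever.ThresholdDoor

open Finset
open Literature.Barriers.ValiantsHypothesis
open Summit.ValiantsHypothesis.ValiantsHypothesis.Theorems.BarrierLever.ProductStatesC
  (coeff_prodStateC twoProdStatesC_mem_smallCircuits)
open Summit.ValiantsHypothesis.ValiantsHypothesis.Theorems.BarrierLever.TwoBlock
  (det_ne_zero_of_twoBlock det_fromBlocks_of_split_ne_zero)

/-- `∏_{a} (if a ∈ s then x^{e a} else 1) = x^{Σ_{a ∈ s} e a}` for integer powers of `x ≠ 0`. -/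
theorem prod_ite_zpow {ι : Type*} [Fintype ι] [DecidableEq ι] (x : ℂ) (hx : x ≠ 0) (s : Finset ι)
    (e : ι → ℤ) : (∏ a, (if a ∈ s then x ^ e a else (1 : ℂ))) = x ^ (∑ a ∈ s, e a) := by
  rw [Finset.prod_ite_mem, Finset.univ_inter]
  induction s using Finset.induction_on with
  | empty => simp
  | insert a s ha ih => rw [Finset.prod_insert ha, Finset.sum_insert ha, ih, zpow_add₀ hx]

/-- Pointwise comparison behind the threshold certificate: with `b j > 0 ↔ j ∈ T`,
`[i ∈ S] b j ≤ [j ∈ T] b j`, with equality iff `i ∈ S ↔ j ∈ T`. -/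
theorem ite_le_ite_of_sign {S T : Prop} [Decidable S] [Decidable T] (b : ℤ) (hb : b ≠ 0)
    (hT : 0 < b ↔ T) :
    (if S then b else 0) ≤ (if T then b else 0) ∧
      ((if S then b else 0) = (if T then b else 0) ↔ (S ↔ T)) := by
  by_cases hS : S <;> by_cases hT' : T
  · rw [if_pos hS, if_pos hT']
    exact ⟨le_rfl, iff_of_true rfl (iff_of_true hS hT')⟩
  · have hneg : b < 0 := lt_of_le_of_ne (not_lt.mp (fun h => hT' (hT.mp h))) hb
    rw [if_pos hS, if_neg hT']
    exact ⟨hneg.le, iff_of_false (ne_of_lt hneg) (fun h => hT' (h.mp hS))⟩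
  · have hpos : 0 < b := hT.mpr hT'
    rw [if_neg hS, if_pos hT']
    exact ⟨hpos.le, iff_of_false (ne_of_lt hpos) (fun h => hS (h.mpr hT'))⟩
  · rw [if_neg hS, if_neg hT']
    exact ⟨le_rfl, iff_of_true rfl (iff_of_false hS hT')⟩


/-- **The bi-threshold door (D-THR).** If the rows above a `λ`-threshold and the columns above a
`μ`-threshold are equinumerous (`e`), their complements too (`e'`), and two product states `P`, `Q`
have nonsingular minors on the two cells (through `e`, `e'`), then the layout is hit inside
`SmallCircuits ℂ (h+h) 3` (`h ≥ 4`). -/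
theorem partitionMinor_hit_of_thresholdSplit (h r : ℕ) (hh : 4 ≤ h) (u w : Fin r → Finset (Fin h))
    (lam mu : Fin h → ℤ) (cu cw : ℤ)
    (e : {i : Fin r // cu < ∑ a ∈ u i, lam a} ≃ {j : Fin r // cw < ∑ c ∈ w j, mu c})
    (e' : {i : Fin r // ¬ cu < ∑ a ∈ u i, lam a} ≃ {j : Fin r // ¬ cw < ∑ c ∈ w j, mu c})
    (P Q : Fin h → Bool → Bool → ℂ)
    (hp : (Matrix.of fun i i' : {i : Fin r // cu < ∑ a ∈ u i, lam a} =>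
        ∏ a : Fin h, P a (decide (a ∈ u i.1)) (decide (a ∈ w (e i').1))).det ≠ 0)
    (hq : (Matrix.of fun i i' : {i : Fin r // ¬ cu < ∑ a ∈ u i, lam a} =>
        ∏ a : Fin h, Q a (decide (a ∈ u i.1)) (decide (a ∈ w (e' i').1))).det ≠ 0) :
    ∃ f ∈ SmallCircuits ℂ (h + h) 3,
      (Matrix.of fun i j : Fin r => MvPolynomial.coeff
        (∑ a ∈ u i, Finsupp.single (Fin.castAdd h a) 1 +
          ∑ c ∈ w j, Finsupp.single (Fin.natAdd h c) 1) f).det ≠ 0 := by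
  classical
  /- §A. integer bookkeeping -/
  set rowv : Fin r → ℤ := fun i => ∑ a ∈ u i, lam a with hrowv
  set colv : Fin r → ℤ := fun j => ∑ c ∈ w j, mu c with hcolv
  set a : Fin r → ℤ := fun i => 2 * (rowv i - cu) - 1 with ha
  set b : Fin r → ℤ := fun j => 2 * (colv j - cw) - 1 with hb
  have ha_pos : ∀ i, 0 < a i ↔ cu < rowv i := fun i => by simp only [ha]; omega
  have hb_pos : ∀ j, 0 < b j ↔ cw < colv j := fun j => by simp only [hb]; omega
  have ha_ne : ∀ i, a i ≠ 0 := fun i => by simp only [ha]; omega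
  have hb_ne : ∀ j, b j ≠ 0 := fun j => by simp only [hb]; omega
  set Mb : ℤ := ∑ j, |b j| with hMb
  set L : ℤ := Mb + 1 with hL
  have hMb0 : 0 ≤ Mb := Finset.sum_nonneg fun j _ => abs_nonneg (b j)
  have hbMb : ∀ j, |b j| ≤ Mb := fun j => by
    have := Finset.single_le_sum (f := fun j => |b j|) (fun j _ => abs_nonneg (b j))
      (Finset.mem_univ j)
    simpa using this
  have hsign : ∀ i j, (0 < L * a i + b j ↔ 0 < a i) ∧ L * a i + b j ≠ 0 := by
    intro i j
    have h1 := hbMb j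
    have h3 := le_abs_self (b j)
    have h4 := neg_abs_le (b j)
    rcases lt_or_gt_of_ne (ha_ne i) with hneg | hpos
    · have h5 : L * a i ≤ -L := by nlinarith
      exact ⟨⟨fun hh => by omega, fun hh => by omega⟩, by omega⟩
    · have h5 : L ≤ L * a i := by nlinarith
      exact ⟨⟨fun _ => hpos, fun _ => by omega⟩, by omega⟩
  set Ma : ℤ := ∑ i, |a i| with hMa
  have hMa0 : 0 ≤ Ma := Finset.sum_nonneg fun i _ => abs_nonneg (a i)
  have haMa : ∀ i, |a i| ≤ Ma := fun i => by
    have := Finset.single_le_sum (f := fun i => |a i|) (fun i _ => abs_nonneg (a i))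
      (Finset.mem_univ i)
    simpa using this
  set C0 : ℤ := L * Ma + Mb with hC0
  have hC0_nonneg : 0 ≤ C0 := by nlinarith
  have hd_nonneg : ∀ i j, 0 ≤ C0 + L * a i + b j := by
    intro i j
    have h1 := haMa i; have h2 := hbMb j
    have h3 := neg_abs_le (a i); have h4 := neg_abs_le (b j)
    nlinarith
  set d : Fin r → Fin r → ℕ := fun i j => (C0 + L * a i + b j).toNat with hd
  set c₀ : ℕ := C0.toNat with hc₀
  have hd_cast : ∀ i j, ((d i j : ℕ) : ℤ) = C0 + L * a i + b j := fun i j =>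
    Int.toNat_of_nonneg (hd_nonneg i j)
  have hc₀_cast : ((c₀ : ℕ) : ℤ) = C0 := Int.toNat_of_nonneg hC0_nonneg
  set S : Finset (Fin r) := Finset.univ.filter (fun i => cu < rowv i) with hS
  set T : Finset (Fin r) := Finset.univ.filter (fun j => cw < colv j) with hT
  have hmemS : ∀ i, i ∈ S ↔ cu < rowv i := fun i => by simp [hS]
  have hmemT : ∀ j, j ∈ T ↔ cw < colv j := fun j => by simp [hT]
  have hK1 : ∀ i j, d i j ≠ c₀ := by
    intro i j hh
    apply (hsign i j).2
    have := congrArg (fun n : ℕ => (n : ℤ)) hh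
    simp only [hd_cast, hc₀_cast] at this
    linarith
  have hK2 : ∀ i j, c₀ < d i j ↔ i ∈ S := by
    intro i j
    rw [hmemS, ← ha_pos, ← (hsign i j).1, ← Nat.cast_lt (α := ℤ), hd_cast, hc₀_cast]
    constructor <;> intro hh <;> linarith
  have htop : ∀ i j, ((max (d i j) c₀ : ℕ) : ℤ) = C0 + (if i ∈ S then L * a i + b j else 0) := by
    intro i j
    rw [Nat.cast_max, hd_cast, hc₀_cast]
    by_cases hi : i ∈ S
    · have := ((hsign i j).1).mpr ((ha_pos i).mpr ((hmemS i).mp hi))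
      rw [if_pos hi, max_eq_left (by linarith)]
      ring
    · have : ¬ 0 < L * a i + b j :=
        fun hh => hi ((hmemS i).mpr ((ha_pos i).mp (((hsign i j).1).mp hh)))
      rw [if_neg hi, add_zero, max_eq_right (by linarith)]
  have hsum : ∀ σ : Equiv.Perm (Fin r), ((∑ j, max (d (σ j) j) c₀ : ℕ) : ℤ) =
      r * C0 + L * (∑ i, if i ∈ S then a i else 0) + ∑ j, (if σ j ∈ S then b j else 0) := by
    intro σ
    rw [Nat.cast_sum]
    simp_rw [htop]
    rw [Finset.sum_add_distrib, Finset.sum_const, Finset.card_univ, Fintype.card_fin,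
      nsmul_eq_mul]
    have hsplit : ∀ j, (if σ j ∈ S then L * a (σ j) + b j else 0) =
        L * (if σ j ∈ S then a (σ j) else 0) + (if σ j ∈ S then b j else 0) := fun j => by
      by_cases hj : σ j ∈ S
      · rw [if_pos hj, if_pos hj, if_pos hj]
      · rw [if_neg hj, if_neg hj, if_neg hj, mul_zero, add_zero]
    simp_rw [hsplit]
    rw [Finset.sum_add_distrib, ← Finset.mul_sum,
      Fintype.sum_equiv σ (fun j => if σ j ∈ S then a (σ j) else 0)
        (fun i => if i ∈ S then a i else 0) (fun j => rfl)]
    ring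
  have hB_le : ∀ σ : Equiv.Perm (Fin r),
      (∑ j, (if σ j ∈ S then b j else 0)) ≤ ∑ j, (if j ∈ T then b j else 0) := fun σ =>
    Finset.sum_le_sum fun j _ =>
      (ite_le_ite_of_sign (b j) (hb_ne j) ((hb_pos j).trans (hmemT j).symm)).1
  have hB_eq : ∀ σ : Equiv.Perm (Fin r), (∀ j, σ j ∈ S ↔ j ∈ T) →
      (∑ j, (if σ j ∈ S then b j else 0)) = ∑ j, (if j ∈ T then b j else 0) := fun σ hσ =>
    Finset.sum_congr rfl fun j _ =>
      ((ite_le_ite_of_sign (b j) (hb_ne j) ((hb_pos j).trans (hmemT j).symm)).2).mpr (hσ j)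
  have hB_lt : ∀ σ : Equiv.Perm (Fin r), ¬ (∀ j, σ j ∈ S ↔ j ∈ T) →
      (∑ j, (if σ j ∈ S then b j else 0)) < ∑ j, (if j ∈ T then b j else 0) := fun σ hσ => by
    obtain ⟨j₀, hj₀⟩ := not_forall.mp hσ
    have key := ite_le_ite_of_sign (S := σ j₀ ∈ S) (b j₀) (hb_ne j₀)
      ((hb_pos j₀).trans (hmemT j₀).symm)
    exact Finset.sum_lt_sum (fun j _ =>
      (ite_le_ite_of_sign (b j) (hb_ne j) ((hb_pos j).trans (hmemT j).symm)).1)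
      ⟨j₀, Finset.mem_univ _, lt_of_le_of_ne key.1 (fun hh => hj₀ (key.2.mp hh))⟩
  set NZ : ℤ := r * C0 + L * (∑ i, if i ∈ S then a i else 0) + ∑ j, (if j ∈ T then b j else 0)
    with hNZ
  have hNZ_nonneg : 0 ≤ NZ := by
    have h0 : (0 : ℤ) ≤ ((∑ j, max (d ((1 : Equiv.Perm (Fin r)) j) j) c₀ : ℕ) : ℤ) :=
      Nat.cast_nonneg _
    rw [hsum 1] at h0
    have := hB_le 1
    linarith
  set N : ℕ := NZ.toNat with hN
  have hN_cast : ((N : ℕ) : ℤ) = NZ := Int.toNat_of_nonneg hNZ_nonneg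
  have htop_eq : ∀ σ : Equiv.Perm (Fin r), (∀ j, σ j ∈ S ↔ j ∈ T) →
      ∑ j, max (d (σ j) j) c₀ = N := fun σ hσ => by
    have h1 := hsum σ
    rw [hB_eq σ hσ] at h1
    exact_mod_cast h1.trans hN_cast.symm
  have htop_lt : ∀ σ : Equiv.Perm (Fin r), ¬ (∀ j, σ j ∈ S ↔ j ∈ T) →
      ∑ j, max (d (σ j) j) c₀ < N := fun σ hσ => by
    have h1 := hsum σ
    have h2 := hB_lt σ hσ
    have : ((∑ j, max (d (σ j) j) c₀ : ℕ) : ℤ) < (N : ℤ) := by rw [h1, hN_cast]; linarith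
    exact_mod_cast this
  /- §B. block matrix and the two-block tropical lemma -/
  set p : Matrix (Fin r) (Fin r) ℂ :=
    Matrix.of fun i j => ∏ a : Fin h, P a (decide (a ∈ u i)) (decide (a ∈ w j)) with hpdef
  set q : Matrix (Fin r) (Fin r) ℂ :=
    Matrix.of fun i j => ∏ a : Fin h, Q a (decide (a ∈ u i)) (decide (a ∈ w j)) with hqdef
  let φS : {i : Fin r // cu < rowv i} ≃ {i // i ∈ S} :=
    Equiv.subtypeEquivRight (fun i => (hmemS i).symm)
  let φT : {j : Fin r // cw < colv j} ≃ {j // j ∈ T} :=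
    Equiv.subtypeEquivRight (fun j => (hmemT j).symm)
  let φS' : {i : Fin r // ¬ cu < rowv i} ≃ {i // i ∉ S} :=
    Equiv.subtypeEquivRight (fun i => by rw [hmemS])
  let φT' : {j : Fin r // ¬ cw < colv j} ≃ {j // j ∉ T} :=
    Equiv.subtypeEquivRight (fun j => by rw [hmemT])
  let eS : {i // i ∈ S} ≃ {j // j ∈ T} := φS.symm.trans (e.trans φT)
  let eS' : {i // i ∉ S} ≃ {j // j ∉ T} := φS'.symm.trans (e'.trans φT')
  have hp' : (Matrix.of fun i i' : {i // i ∈ S} => p i (eS i')).det ≠ 0 := by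
    have hre : (Matrix.of fun i i' : {i // i ∈ S} => p i (eS i')) =
        (Matrix.of fun i i' : {i : Fin r // cu < rowv i} =>
          ∏ a : Fin h, P a (decide (a ∈ u i.1)) (decide (a ∈ w (e i').1))).reindex φS φS := by
      ext i i'
      rfl
    rw [hre, Matrix.det_reindex_self]
    exact hp
  have hq' : (Matrix.of fun i i' : {i // i ∉ S} => q i (eS' i')).det ≠ 0 := by
    have hre : (Matrix.of fun i i' : {i // i ∉ S} => q i (eS' i')) =
        (Matrix.of fun i i' : {i : Fin r // ¬ cu < rowv i} =>
          ∏ a : Fin h, Q a (decide (a ∈ u i.1)) (decide (a ∈ w (e' i').1))).reindex φS' φS' := by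
      ext i i'
      rfl
    rw [hre, Matrix.det_reindex_self]
    exact hq
  have hG := det_fromBlocks_of_split_ne_zero p q S T eS eS' hp' hq'
  have hA := det_ne_zero_of_twoBlock p q d c₀ S T hK1 hK2 N htop_eq htop_lt hG
  /- §C. an evaluation point -/
  set A : Matrix (Fin r) (Fin r) (Polynomial ℂ) := Matrix.of fun i j : Fin r =>
    Polynomial.C (p i j) * Polynomial.X ^ d i j + Polynomial.C (q i j) * Polynomial.X ^ c₀ with hAdef
  have hD : (Polynomial.X * A.det) ≠ 0 := mul_ne_zero Polynomial.X_ne_zero hA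
  obtain ⟨x₀, hx₀⟩ := Infinite.exists_notMem_finset (Polynomial.X * A.det).roots.toFinset
  rw [Multiset.mem_toFinset, Polynomial.mem_roots hD, Polynomial.IsRoot.def, Polynomial.eval_mul,
    Polynomial.eval_X, mul_eq_zero, not_or] at hx₀
  obtain ⟨hx₀ne, hdetx⟩ := hx₀
  have hevaldet : Polynomial.eval x₀ A.det =
      (Matrix.of fun i j : Fin r => p i j * x₀ ^ d i j + q i j * x₀ ^ c₀).det := by
    rw [← Polynomial.coe_evalRingHom, RingHom.map_det]
    congr 1
    ext i j
    simp [hAdef, RingHom.mapMatrix_apply, Matrix.map_apply]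
  /- §D. the witness: two scaled product states -/
  set K : ℤ := C0 - 2 * L * cu - L - 2 * cw - 1 with hK
  have hdZ : ∀ i j, ((d i j : ℕ) : ℤ) = K + (∑ a ∈ u i, 2 * L * lam a) + ∑ c ∈ w j, 2 * mu c := by
    intro i j
    have h1 : (∑ a ∈ u i, 2 * L * lam a) = 2 * L * rowv i := by
      rw [hrowv, Finset.mul_sum]
    have h2 : (∑ c ∈ w j, 2 * mu c) = 2 * colv j := by
      rw [hcolv, Finset.mul_sum]
    rw [h1, h2, hd_cast, hK, ha, hb]
    ring
  set m₁ : Fin h → Bool → Bool → ℂ := fun a ε η =>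
    (cond ε (x₀ ^ (2 * L * lam a)) 1) * (cond η (x₀ ^ (2 * mu a)) 1) * P a ε η with hm₁
  refine ⟨_, twoProdStatesC_mem_smallCircuits hh (x₀ ^ K) (x₀ ^ c₀) m₁ Q, ?_⟩
  -- its 19717 matrix is the evaluated tropical matrix
  have hcoef : ∀ i j : Fin r, MvPolynomial.coeff
      (∑ a ∈ u i, Finsupp.single (Fin.castAdd h a) 1 + ∑ c ∈ w j, Finsupp.single (Fin.natAdd h c) 1)
      (MvPolynomial.C (x₀ ^ K) * (∏ a, ∑ p : Bool × Bool, MvPolynomial.C (m₁ a p.1 p.2) *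
          MvPolynomial.X (Fin.castAdd h a) ^ p.1.toNat *
          MvPolynomial.X (Fin.natAdd h ((Equiv.refl (Fin h)) a)) ^ p.2.toNat) +
        MvPolynomial.C (x₀ ^ c₀) * (∏ a, ∑ p : Bool × Bool, MvPolynomial.C (Q a p.1 p.2) *
          MvPolynomial.X (Fin.castAdd h a) ^ p.1.toNat *
          MvPolynomial.X (Fin.natAdd h ((Equiv.refl (Fin h)) a)) ^ p.2.toNat) :
          MvPolynomial (Fin (h + h)) ℂ) = p i j * x₀ ^ d i j + q i j * x₀ ^ c₀ := by
    intro i j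
    rw [MvPolynomial.coeff_add, MvPolynomial.coeff_C_mul, MvPolynomial.coeff_C_mul,
      coeff_prodStateC, coeff_prodStateC]
    have hP : (∏ a : Fin h, m₁ a (decide (a ∈ u i)) (decide ((Equiv.refl (Fin h)) a ∈ w j))) =
        (∏ a : Fin h, (if a ∈ u i then x₀ ^ (2 * L * lam a) else (1 : ℂ))) *
        (∏ a : Fin h, (if a ∈ w j then x₀ ^ (2 * mu a) else (1 : ℂ))) * p i j := by
      rw [hpdef, Matrix.of_apply, ← Finset.prod_mul_distrib, ← Finset.prod_mul_distrib]
      refine Finset.prod_congr rfl fun a _ => ?_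
      simp only [hm₁, Bool.cond_decide, Equiv.refl_apply]
      rfl
    have hQ : (∏ a : Fin h, Q a (decide (a ∈ u i)) (decide ((Equiv.refl (Fin h)) a ∈ w j))) =
        q i j := by
      rw [hqdef, Matrix.of_apply]
      rfl
    rw [hP, hQ, prod_ite_zpow x₀ hx₀ne, prod_ite_zpow x₀ hx₀ne]
    have hpow : x₀ ^ K * (x₀ ^ (∑ a ∈ u i, 2 * L * lam a) * x₀ ^ (∑ c ∈ w j, 2 * mu c)) =
        x₀ ^ (d i j) := by
      rw [← zpow_natCast, hdZ, zpow_add₀ hx₀ne, zpow_add₀ hx₀ne]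
      ring
    calc x₀ ^ K * (x₀ ^ (∑ a ∈ u i, 2 * L * lam a) * x₀ ^ (∑ c ∈ w j, 2 * mu c) * p i j) +
          x₀ ^ c₀ * q i j
        = (x₀ ^ K * (x₀ ^ (∑ a ∈ u i, 2 * L * lam a) * x₀ ^ (∑ c ∈ w j, 2 * mu c))) * p i j +
          x₀ ^ c₀ * q i j := by ring
      _ = p i j * x₀ ^ d i j + q i j * x₀ ^ c₀ := by rw [hpow]; ring
  have hM : (Matrix.of fun i j : Fin r => MvPolynomial.coeff
      (∑ a ∈ u i, Finsupp.single (Fin.castAdd h a) 1 + ∑ c ∈ w j, Finsupp.single (Fin.natAdd h c) 1)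
      (MvPolynomial.C (x₀ ^ K) * (∏ a, ∑ p : Bool × Bool, MvPolynomial.C (m₁ a p.1 p.2) *
          MvPolynomial.X (Fin.castAdd h a) ^ p.1.toNat *
          MvPolynomial.X (Fin.natAdd h ((Equiv.refl (Fin h)) a)) ^ p.2.toNat) +
        MvPolynomial.C (x₀ ^ c₀) * (∏ a, ∑ p : Bool × Bool, MvPolynomial.C (Q a p.1 p.2) *
          MvPolynomial.X (Fin.castAdd h a) ^ p.1.toNat *
          MvPolynomial.X (Fin.natAdd h ((Equiv.refl (Fin h)) a)) ^ p.2.toNat) :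
          MvPolynomial (Fin (h + h)) ℂ)) =
      Matrix.of fun i j : Fin r => p i j * x₀ ^ d i j + q i j * x₀ ^ c₀ := by
    ext i j
    rw [Matrix.of_apply, Matrix.of_apply, hcoef]
  rw [hM, ← hevaldet]
  exact hdetx

end Summit.ValiantsHypothesis.ValiantsHypothesis.Theorems.BarrierLever.ThresholdDoor
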